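import Mathlib
import Literature.NumberTheory.LFunctions.WeilFourierGridWindow

/-!
# The window estimate for an arbitrary finite set of vanishing frequencies, and for shifted grids

Literature/NumberTheory/LFunctions.  Sequel of `WeilFourierGridWindow.lean` (Yoshida 1992 §6 (6.4) in finite
projection form for the grid `πℤ/a`).  Two generalisations needed by Fourier–Galerkin certificates that use
OTHER orthogonal exponential families on the window — notably the half-range (Neumann / quarter-wave) family
`e^{±iπ(j+½)x/a}` for the odd sector (frequencies `π(j+½)/a`, still pairwise orthogonal on `[-a, a]`):

* `re_inner_le_of_freq_zero`, `norm_sq_weilMellin_le_of_freq_zero` — the Bessel / Cauchy–Schwarz bound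
  `|ĝ(1/2+it)|² ≤ ‖g‖₂² ∫_{-a}^{a} |e^{itx} − Σ_{ω∈Ω} λ_ω e^{iωx}|² dx` for ANY finite set `Ω ⊂ ℝ` of real
  frequencies at which `ĝ(1/2 + iω) = 0` (no orthogonality needed);
* `intervalIntegral_norm_sq_cexp_sub_sum_shift`, `norm_sq_weilMellin_le_of_shiftedGrid_zero_sinc` — the closed
  form and the projection bound for a SHIFTED grid `ω₀ + πn/a`, `n ∈ S ⊂ ℤ` (orthogonality only uses frequency
  differences in `(π/a)ℤ`): `|ĝ(1/2+it)|² ≤ ‖g‖₂² (2a − (1/2a) Σ_{n∈S} (2 sin((t−ω₀−πn/a)a)/(t−ω₀−πn/a))²)`;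
  `ω₀ = π/(2a)` is the half-integer grid of the quarter-wave basis.

[cite: Yoshida1992HermitianForms, §3 Lemma 3 and §6 (6.4)]  RH-free; no definitions, no named facts.
-/

noncomputable section

open Complex Set MeasureTheory Filter
open scoped Real Topology ComplexConjugate

namespace Literature.NumberTheory.LFunctions

variable {g : ℝ → ℂ}

/-! ### Exponential integrals on `[-a, a]` (private copies of the helpers of `WeilFourierGridWindow`) -/

/-- `∫_{-a}^{a} e^{icx} dx = 2 sin(ca)/c` for real `c ≠ 0`. [folklore] -/
private theorem intervalIntegral_cexp_mul_I' {a c : ℝ} (hc : c ≠ 0) :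
    ∫ x in (-a)..a, cexp (c * I * x) = ((2 * Real.sin (c * a) / c : ℝ) : ℂ) := by
  have hc' : (c : ℂ) * I ≠ 0 := mul_ne_zero (ofReal_ne_zero.mpr hc) I_ne_zero
  rw [integral_exp_mul_complex hc']
  have e1 : (c : ℂ) * I * (a : ℝ) = (c * a : ℝ) * I := by push_cast; ring
  have e2 : (c : ℂ) * I * (-a : ℝ) = -((c * a : ℝ)) * I := by push_cast; ring
  rw [e1, e2]
  have hsin : cexp ((c * a : ℝ) * I) - cexp (-(c * a : ℝ) * I) = 2 * I * Complex.sin (c * a : ℝ) := by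
    rw [Complex.sin]
    linear_combination (cexp ((c * a : ℝ) * I) - cexp (-(c * a : ℝ) * I)) * I_mul_I
  rw [hsin, ← Complex.ofReal_sin]
  have hI : (I : ℂ) ≠ 0 := I_ne_zero
  have hc0 : (c : ℂ) ≠ 0 := ofReal_ne_zero.mpr hc
  push_cast
  field_simp

/-- `∫_{-a}^{a} e^{i0x} dx = 2a`. [folklore] -/
private theorem intervalIntegral_cexp_zero_mul' (a : ℝ) :
    ∫ x in (-a)..a, cexp ((0 : ℝ) * I * x) = ((2 * a : ℝ) : ℂ) := by
  simp only [ofReal_zero, zero_mul, Complex.exp_zero]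
  rw [intervalIntegral.integral_const]
  simp
  ring

/-- `conj (e^{icx}) = e^{-icx}` for real `c, x`. [folklore] -/
private theorem conj_cexp_mul_I' (c x : ℝ) : conj (cexp (c * I * x)) = cexp ((-c : ℝ) * I * x) := by
  rw [← Complex.exp_conj]
  congr 1
  simp only [map_mul, Complex.conj_ofReal, Complex.conj_I, ofReal_neg]
  ring

/-- `e^{ic₁x} e^{ic₂x} = e^{i(c₁+c₂)x}` for real `c₁, c₂, x`. [folklore] -/
private theorem cexp_mul_I_mul_cexp_mul_I' (c₁ c₂ x : ℝ) :
    cexp (c₁ * I * x) * cexp (c₂ * I * x) = cexp ((c₁ + c₂ : ℝ) * I * x) := by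
  rw [← Complex.exp_add]
  congr 1
  push_cast
  ring

/-! ### Arbitrary finite frequency sets -/

/-- If `ĝ(1/2 + iω) = 0` for every `ω ∈ Ω`, then `g` pairs with `e^{itx} − Σ_{ω∈Ω} λ_ω e^{iωx}` to
`ĝ(1/2+it)`. [folklore] -/
private theorem integral_mul_cexp_sub_sum_freq_eq_weilMellin (hg : IsWeilTest g) (Ω : Finset ℝ)
    (hzero : ∀ ω ∈ Ω, weilMellin g (1 / 2 + (ω : ℂ) * I) = 0) (lam : ℝ → ℂ) (t : ℝ) :
    ∫ x : ℝ, g x * (cexp (t * I * x) - ∑ ω ∈ Ω, lam ω * cexp (ω * I * x))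
      = weilMellin g (1 / 2 + t * I) := by
  have hexpc : ∀ c : ℝ, Continuous fun x : ℝ ↦ cexp (c * I * x) := fun c ↦ by fun_prop
  have i0 : Integrable fun x : ℝ ↦ g x * cexp (t * I * x) := hg.integrable_mul (hexpc t)
  have iS : ∀ ω : ℝ, Integrable fun x : ℝ ↦ g x * (lam ω * cexp (ω * I * x)) :=
    fun ω ↦ hg.integrable_mul (continuous_const.mul (hexpc _))
  have e1 : (fun x : ℝ ↦ g x * (cexp (t * I * x) - ∑ ω ∈ Ω, lam ω * cexp (ω * I * x)))
      = fun x ↦ g x * cexp (t * I * x) - ∑ ω ∈ Ω, g x * (lam ω * cexp (ω * I * x)) := by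
    funext x
    rw [mul_sub, Finset.mul_sum]
  rw [e1, integral_sub i0 (integrable_finsetSum _ fun ω _ ↦ iS ω),
    integral_finsetSum _ fun ω _ ↦ iS ω, weilMellin_half_line_eq]
  have hv : ∀ ω ∈ Ω, ∫ x : ℝ, g x * (lam ω * cexp (ω * I * x)) = 0 := by
    intro ω hω
    have e2 : (fun x : ℝ ↦ g x * (lam ω * cexp (ω * I * x)))
        = fun x ↦ lam ω * (g x * cexp (ω * I * x)) := by
      funext x; ring
    rw [e2, integral_const_mul, ← weilMellin_half_line_eq, hzero ω hω, mul_zero]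
  rw [Finset.sum_eq_zero hv, sub_zero]

/-- **Bessel form of the window estimate for an arbitrary finite frequency set.**  For
`tsupport g ⊆ [-a, a]`, `ĝ(1/2 + iω) = 0` (`ω ∈ Ω`), any `μ ∈ ℂ`, `t ∈ ℝ` and coefficients `λ`:
`2 Re(conj μ · ĝ(1/2+it)) ≤ ‖g‖₂² + |μ|² ∫_{-a}^{a} |e^{itx} − Σ_{ω∈Ω} λ_ω e^{iωx}|² dx`.
[cite: Yoshida1992HermitianForms, §6 (6.4) (finite projection form, arbitrary frequencies)] -/
theorem re_inner_le_of_freq_zero (hg : IsWeilTest g) {a : ℝ} (ha : 0 < a)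
    (hsupp : tsupport g ⊆ Icc (-a) a) (Ω : Finset ℝ)
    (hzero : ∀ ω ∈ Ω, weilMellin g (1 / 2 + (ω : ℂ) * I) = 0)
    (lam : ℝ → ℂ) (t : ℝ) (μ : ℂ) :
    2 * (conj μ * weilMellin g (1 / 2 + t * I)).re ≤
      weilNorm2Sq g + ‖μ‖ ^ 2 *
        ∫ x in (-a)..a, ‖cexp (t * I * x) - ∑ ω ∈ Ω, lam ω * cexp (ω * I * x)‖ ^ 2 := by
  have hgc : Continuous g := hg.1.continuous
  have hab : -a ≤ a := by linarith
  set h : ℝ → ℂ := fun x ↦ cexp (t * I * x) - ∑ ω ∈ Ω, lam ω * cexp (ω * I * x) with hh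
  have hhc : Continuous h := by
    rw [hh]
    exact (by fun_prop : Continuous fun x : ℝ ↦ cexp (t * I * x)).sub
      (continuous_finsetSum _ fun ω _ ↦ by fun_prop)
  set Q : ℝ → ℂ := fun x ↦ μ * conj (h x) with hQ
  have hQc : Continuous Q := continuous_const.mul (Complex.continuous_conj.comp hhc)
  have hQs : Continuous fun x ↦ conj (Q x) := Complex.continuous_conj.comp hQc
  -- (1) `0 ≤ ∫_{-a}^{a} ‖g - Q‖²`
  have h0 : 0 ≤ ∫ x in (-a)..a, ‖g x - Q x‖ ^ 2 :=
    intervalIntegral.integral_nonneg hab fun x _ ↦ sq_nonneg _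
  -- (2) expand the square
  have i1 : IntervalIntegrable (fun x ↦ ‖g x‖ ^ 2) volume (-a) a :=
    ((hgc.norm).pow 2).intervalIntegrable _ _
  have i2 : IntervalIntegrable (fun x ↦ ‖Q x‖ ^ 2) volume (-a) a :=
    ((hQc.norm).pow 2).intervalIntegrable _ _
  have iGQ : IntervalIntegrable (fun x ↦ g x * conj (Q x)) volume (-a) a :=
    (hgc.mul hQs).intervalIntegrable _ _
  have i3 : IntervalIntegrable (fun x ↦ 2 * (g x * conj (Q x)).re) volume (-a) a :=
    (continuous_const.mul (Complex.continuous_re.comp (hgc.mul hQs))).intervalIntegrable _ _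
  have hexp : ∫ x in (-a)..a, ‖g x - Q x‖ ^ 2 =
      (∫ x in (-a)..a, ‖g x‖ ^ 2) + (∫ x in (-a)..a, ‖Q x‖ ^ 2) -
        2 * ∫ x in (-a)..a, (g x * conj (Q x)).re := by
    simp_rw [norm_sub_sq_complex]
    rw [intervalIntegral.integral_sub (i1.add i2) i3, intervalIntegral.integral_add i1 i2,
      intervalIntegral.integral_const_mul]
  -- (3) `∫_{-a}^{a} ‖g‖² = ‖g‖₂²`
  have hN : ∫ x in (-a)..a, ‖g x‖ ^ 2 = weilNorm2Sq g := by
    rw [weilNorm2Sq]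
    apply intervalIntegral.integral_eq_integral_of_support_subset
    intro x hx
    have hgx : g x ≠ 0 := fun h0 ↦ hx (by simp [h0])
    exact Ioo_subset_Ioc_self (support_subset_Ioo_of_tsupport_subset_Icc hgc hsupp hgx)
  -- `∫ Re = Re ∫` on `[-a, a]`
  have hre : ∀ {F : ℝ → ℂ}, IntervalIntegrable F volume (-a) a →
      ∫ x in (-a)..a, (F x).re = (∫ x in (-a)..a, F x).re := by
    intro F hF
    have := ContinuousLinearMap.intervalIntegral_comp_comm Complex.reCLM hF
    simpa only [Complex.reCLM_apply] using this
  -- (4) the cross term: `∫ g conj(Q) = conj μ · ĝ(1/2+it)`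
  have hcross : ∫ x in (-a)..a, (g x * conj (Q x)).re =
      (conj μ * weilMellin g (1 / 2 + t * I)).re := by
    rw [hre iGQ]
    congr 1
    have e1 : (fun x ↦ g x * conj (Q x)) = fun x ↦ conj μ * (g x * h x) := by
      funext x
      rw [hQ]
      simp only [map_mul, Complex.conj_conj]
      ring
    rw [e1, intervalIntegral.integral_const_mul]
    congr 1
    rw [← integral_eq_intervalIntegral_of_tsupport hgc hsupp h, hh]
    exact integral_mul_cexp_sub_sum_freq_eq_weilMellin hg Ω hzero lam t
  -- (5) the trial term: `∫ ‖Q‖² = |μ|² ∫ ‖h‖²`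
  have hQQ : ∫ x in (-a)..a, ‖Q x‖ ^ 2 = ‖μ‖ ^ 2 * ∫ x in (-a)..a, ‖h x‖ ^ 2 := by
    rw [← intervalIntegral.integral_const_mul]
    refine intervalIntegral.integral_congr fun x _ ↦ ?_
    simp only [hQ, norm_mul, Complex.norm_conj]
    ring
  rw [hexp, hN, hcross, hQQ] at h0
  linarith

/-- **The window estimate (Cauchy–Schwarz form) for an arbitrary finite frequency set.**
`|ĝ(1/2+it)|² ≤ ‖g‖₂² · ∫_{-a}^{a} |e^{itx} − Σ_{ω∈Ω} λ_ω e^{iωx}|² dx` whenever `ĝ(1/2+iω) = 0` on `Ω`.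
[cite: Yoshida1992HermitianForms, §6 (6.4)] -/
theorem norm_sq_weilMellin_le_of_freq_zero (hg : IsWeilTest g) {a : ℝ} (ha : 0 < a)
    (hsupp : tsupport g ⊆ Icc (-a) a) (Ω : Finset ℝ)
    (hzero : ∀ ω ∈ Ω, weilMellin g (1 / 2 + (ω : ℂ) * I) = 0)
    (lam : ℝ → ℂ) (t : ℝ) :
    ‖weilMellin g (1 / 2 + t * I)‖ ^ 2 ≤
      weilNorm2Sq g *
        ∫ x in (-a)..a, ‖cexp (t * I * x) - ∑ ω ∈ Ω, lam ω * cexp (ω * I * x)‖ ^ 2 := by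
  have key := fun μ : ℂ ↦ re_inner_le_of_freq_zero hg ha hsupp Ω hzero lam t μ
  set z : ℂ := weilMellin g (1 / 2 + t * I) with hz
  set H : ℝ := ∫ x in (-a)..a, ‖cexp (t * I * x) - ∑ ω ∈ Ω, lam ω * cexp (ω * I * x)‖ ^ 2
    with hH
  have hG : 0 ≤ weilNorm2Sq g := weilNorm2Sq_nonneg g
  have hH0 : 0 ≤ H := intervalIntegral.integral_nonneg (by linarith) fun x _ ↦ sq_nonneg _
  -- `conj z · z = |z|²`
  have hzz : ∀ s : ℝ, (conj ((s : ℂ) * z) * z).re = s * ‖z‖ ^ 2 := by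
    intro s
    rw [map_mul, Complex.conj_ofReal, mul_assoc, Complex.re_ofReal_mul, Complex.conj_mul',
      ← Complex.ofReal_pow, Complex.ofReal_re]
  rcases eq_or_lt_of_le hH0 with hH | hH
  · -- `H = 0`: take `μ = s z`, `s → ∞`
    have hs : ∀ s : ℝ, 2 * (s * ‖z‖ ^ 2) ≤ weilNorm2Sq g := by
      intro s
      have := key ((s : ℂ) * z)
      rw [hzz, ← hH, mul_zero, add_zero] at this
      exact this
    have hz0 : ‖z‖ ^ 2 = 0 := by
      by_contra hne
      have hpos : 0 < ‖z‖ ^ 2 := lt_of_le_of_ne (sq_nonneg _) (Ne.symm hne)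
      have := hs ((weilNorm2Sq g + 1) / (2 * ‖z‖ ^ 2))
      have hzne : ‖z‖ ≠ 0 := fun h0 ↦ by rw [h0] at hpos; simp at hpos
      have e : 2 * ((weilNorm2Sq g + 1) / (2 * ‖z‖ ^ 2) * ‖z‖ ^ 2) = weilNorm2Sq g + 1 := by
        field_simp
      linarith
    rw [hz0, ← hH, mul_zero]
  · -- `H > 0`: take `μ = z / H`
    have := key (((1 / H : ℝ) : ℂ) * z)
    rw [hzz, norm_mul, Complex.norm_real, Real.norm_of_nonneg (by positivity), mul_pow] at this
    -- this : 2 * (1/H * ‖z‖²) ≤ G + (1/H)² ‖z‖² * H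
    have e : (1 / H) ^ 2 * ‖z‖ ^ 2 * H = 1 / H * ‖z‖ ^ 2 := by
      field_simp
    rw [e] at this
    have h2 : 1 / H * ‖z‖ ^ 2 ≤ weilNorm2Sq g := by linarith
    calc ‖z‖ ^ 2 = H * (1 / H * ‖z‖ ^ 2) := by field_simp
      _ ≤ H * weilNorm2Sq g := mul_le_mul_of_nonneg_left h2 hH.le
      _ = weilNorm2Sq g * H := mul_comm _ _

/-! ### Shifted grids `ω₀ + πn/a` -/

/-- Gram integrals of a shifted grid: `∫_{-a}^{a} conj(e^{i(ω₀+πn/a)x}) e^{i(ω₀+πm/a)x} dx = 2a δ_{nm}`. [folklore] -/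
private theorem intervalIntegral_conj_cexp_shiftedGrid_mul (a ω₀ : ℝ) (ha : a ≠ 0) (n m : ℤ) :
    ∫ x in (-a)..a, conj (cexp ((ω₀ + π * n / a : ℝ) * I * x)) * cexp ((ω₀ + π * m / a : ℝ) * I * x)
      = if n = m then ((2 * a : ℝ) : ℂ) else 0 := by
  simp_rw [conj_cexp_mul_I', cexp_mul_I_mul_cexp_mul_I']
  split_ifs with hnm
  · subst hnm
    have : (-(ω₀ + π * n / a) + (ω₀ + π * n / a) : ℝ) = 0 := by ring
    rw [this, intervalIntegral_cexp_zero_mul']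
  · have : (-(ω₀ + π * n / a) + (ω₀ + π * m / a) : ℝ) = π * (m - n) / a := by ring
    rw [this]
    have hk : ((m : ℝ) - n) ≠ 0 := by
      have : (m : ℝ) ≠ n := by exact_mod_cast (Ne.symm hnm)
      exact sub_ne_zero.mpr this
    have hc : (π * (m - n) / a : ℝ) ≠ 0 := by
      refine div_ne_zero (mul_ne_zero Real.pi_ne_zero ?_) ha
      exact_mod_cast hk
    rw [intervalIntegral_cexp_mul_I' hc]
    have hsin : Real.sin (π * (m - n) / a * a) = 0 := by
      rw [div_mul_cancel₀ _ ha]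
      have : π * ((m : ℝ) - n) = ((m - n : ℤ) : ℝ) * π := by push_cast; ring
      rw [this]
      exact Real.sin_int_mul_pi _
    rw [hsin]
    simp

/-- **Closed form of the trial integral for a shifted grid.**  For `a ≠ 0`, `ω₀ ∈ ℝ`, coefficients `λ` and
`σ_n(t) := ∫_{-a}^{a} e^{i(t − ω₀ − πn/a)x} dx`:
`∫_{-a}^{a} |e^{itx} − Σ_{n∈S} λ_n e^{i(ω₀+πn/a)x}|² dx = 2a − 2 Re Σ_{n∈S} conj(λ_n) σ_n(t) + 2a Σ_{n∈S} |λ_n|²`.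
[cite: Yoshida1992HermitianForms, §3 pp. 289–290 and §6 (6.4)] -/
theorem intervalIntegral_norm_sq_cexp_sub_sum_shift {a : ℝ} (ha : a ≠ 0) (ω₀ : ℝ) (S : Finset ℤ)
    (lam : ℤ → ℂ) (t : ℝ) :
    ∫ x in (-a)..a, ‖cexp (t * I * x) - ∑ n ∈ S, lam n * cexp ((ω₀ + π * n / a : ℝ) * I * x)‖ ^ 2
      = 2 * a - 2 * (∑ n ∈ S, conj (lam n) * ∫ x in (-a)..a, cexp ((t - (ω₀ + π * n / a) : ℝ) * I * x)).re
          + 2 * a * ∑ n ∈ S, ‖lam n‖ ^ 2 := by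
  set e : ℝ → ℂ := fun x ↦ cexp (t * I * x) with he
  set b : ℤ → ℝ → ℂ := fun n x ↦ cexp ((ω₀ + π * n / a : ℝ) * I * x) with hb
  set Q : ℝ → ℂ := fun x ↦ ∑ n ∈ S, lam n * b n x with hQ
  have hec : Continuous e := by rw [he]; fun_prop
  have hbc : ∀ n, Continuous (b n) := fun n ↦ by rw [hb]; fun_prop
  have hQc : Continuous Q := by
    rw [hQ]; exact continuous_finsetSum _ fun n _ ↦ continuous_const.mul (hbc n)
  have hQs : Continuous fun x ↦ conj (Q x) := Complex.continuous_conj.comp hQc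
  -- `∫ Re = Re ∫`
  have hre : ∀ {F : ℝ → ℂ}, IntervalIntegrable F volume (-a) a →
      ∫ x in (-a)..a, (F x).re = (∫ x in (-a)..a, F x).re := by
    intro F hF
    have := ContinuousLinearMap.intervalIntegral_comp_comm Complex.reCLM hF
    simpa only [Complex.reCLM_apply] using this
  -- expand the square
  have i1 : IntervalIntegrable (fun x ↦ ‖e x‖ ^ 2) volume (-a) a := ((hec.norm).pow 2).intervalIntegrable _ _
  have i2 : IntervalIntegrable (fun x ↦ ‖Q x‖ ^ 2) volume (-a) a := ((hQc.norm).pow 2).intervalIntegrable _ _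
  have iEQ : IntervalIntegrable (fun x ↦ e x * conj (Q x)) volume (-a) a := (hec.mul hQs).intervalIntegrable _ _
  have iQQ : IntervalIntegrable (fun x ↦ conj (Q x) * Q x) volume (-a) a := (hQs.mul hQc).intervalIntegrable _ _
  have i3 : IntervalIntegrable (fun x ↦ 2 * (e x * conj (Q x)).re) volume (-a) a :=
    (continuous_const.mul (Complex.continuous_re.comp (hec.mul hQs))).intervalIntegrable _ _
  have hexp : ∫ x in (-a)..a, ‖e x - Q x‖ ^ 2 =
      (∫ x in (-a)..a, ‖e x‖ ^ 2) + (∫ x in (-a)..a, ‖Q x‖ ^ 2) -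
        2 * ∫ x in (-a)..a, (e x * conj (Q x)).re := by
    simp_rw [norm_sub_sq_complex]
    rw [intervalIntegral.integral_sub (i1.add i2) i3, intervalIntegral.integral_add i1 i2,
      intervalIntegral.integral_const_mul]
  -- `‖e‖² = 1`
  have hE : ∫ x in (-a)..a, ‖e x‖ ^ 2 = 2 * a := by
    have h1 : ∀ x : ℝ, ‖e x‖ ^ 2 = 1 := by
      intro x
      rw [he]
      simp only
      rw [show (t : ℂ) * I * x = ((t * x : ℝ) : ℂ) * I by push_cast; ring, Complex.norm_exp_ofReal_mul_I,
        one_pow]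
    simp_rw [h1]
    rw [intervalIntegral.integral_const, smul_eq_mul, mul_one]
    ring
  -- cross term
  have hcross : ∫ x in (-a)..a, (e x * conj (Q x)).re =
      (∑ n ∈ S, conj (lam n) * ∫ x in (-a)..a, cexp ((t - (ω₀ + π * n / a) : ℝ) * I * x)).re := by
    rw [hre iEQ]
    congr 1
    have e1 : ∀ x, e x * conj (Q x) = ∑ n ∈ S, conj (lam n) * cexp ((t - (ω₀ + π * n / a) : ℝ) * I * x) := by
      intro x
      rw [hQ, he, hb]
      simp only [map_sum, map_mul, Finset.mul_sum]
      refine Finset.sum_congr rfl fun n _ ↦ ?_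
      rw [conj_cexp_mul_I', show cexp (t * I * x) * (conj (lam n) * cexp ((-(ω₀ + π * n / a) : ℝ) * I * x))
        = conj (lam n) * (cexp (t * I * x) * cexp ((-(ω₀ + π * n / a) : ℝ) * I * x)) by ring,
        cexp_mul_I_mul_cexp_mul_I']
      congr 3
    simp_rw [e1]
    have iN : ∀ n, IntervalIntegrable (fun x ↦ conj (lam n) * cexp ((t - (ω₀ + π * n / a) : ℝ) * I * x)) volume (-a) a :=
      fun n ↦ (continuous_const.mul (by fun_prop)).intervalIntegrable _ _
    rw [intervalIntegral.integral_finsetSum fun n _ ↦ iN n]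
    refine Finset.sum_congr rfl fun n _ ↦ ?_
    rw [intervalIntegral.integral_const_mul]
  -- Gram term
  have hgram : ∫ x in (-a)..a, ‖Q x‖ ^ 2 = 2 * a * ∑ n ∈ S, ‖lam n‖ ^ 2 := by
    have e1 : ∀ x, (‖Q x‖ ^ 2 : ℝ) = (conj (Q x) * Q x).re := by
      intro x
      rw [Complex.sq_norm, ← Complex.normSq_eq_conj_mul_self]
      simp
    have e2 : ∀ x, conj (Q x) * Q x =
        ∑ n ∈ S, ∑ m ∈ S, conj (lam n) * lam m * (conj (b n x) * b m x) := by
      intro x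
      rw [hQ]
      simp only [map_sum, map_mul]
      rw [Finset.sum_mul_sum]
      refine Finset.sum_congr rfl fun n _ ↦ Finset.sum_congr rfl fun m _ ↦ ?_
      ring
    simp_rw [e1]
    rw [hre iQQ]
    simp_rw [e2]
    have iNM : ∀ n m, IntervalIntegrable (fun x ↦ conj (lam n) * lam m * (conj (b n x) * b m x)) volume (-a) a :=
      fun n m ↦ (continuous_const.mul ((Complex.continuous_conj.comp (hbc n)).mul (hbc m))).intervalIntegrable _ _
    have iNs : ∀ n, IntervalIntegrable (fun x ↦ ∑ m ∈ S, conj (lam n) * lam m * (conj (b n x) * b m x)) volume (-a) a :=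
      fun n ↦ (continuous_finsetSum _ fun m _ ↦
        continuous_const.mul ((Complex.continuous_conj.comp (hbc n)).mul (hbc m))).intervalIntegrable _ _
    rw [intervalIntegral.integral_finsetSum fun n _ ↦ iNs n]
    have hin : ∀ n ∈ S, ∫ x in (-a)..a, ∑ m ∈ S, conj (lam n) * lam m * (conj (b n x) * b m x)
        = conj (lam n) * lam n * ((2 * a : ℝ) : ℂ) := by
      intro n hn
      rw [intervalIntegral.integral_finsetSum fun m _ ↦ iNM n m]
      have hm : ∀ m ∈ S, ∫ x in (-a)..a, conj (lam n) * lam m * (conj (b n x) * b m x)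
          = if n = m then conj (lam n) * lam n * ((2 * a : ℝ) : ℂ) else 0 := by
        intro m _
        rw [intervalIntegral.integral_const_mul, hb]
        simp only
        rw [intervalIntegral_conj_cexp_shiftedGrid_mul a ω₀ ha n m]
        split_ifs with h
        · subst h; rfl
        · rw [mul_zero]
      rw [Finset.sum_congr rfl hm, Finset.sum_ite_eq S n, if_pos hn]
    rw [Finset.sum_congr rfl hin, ← Finset.sum_mul, Complex.re_mul_ofReal]
    have h3 : (∑ n ∈ S, conj (lam n) * lam n).re = ∑ n ∈ S, ‖lam n‖ ^ 2 := by
      rw [Complex.re_sum]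
      refine Finset.sum_congr rfl fun n _ ↦ ?_
      rw [Complex.conj_mul', ← Complex.ofReal_pow, Complex.ofReal_re]
    rw [h3]
    ring
  have hlhs : (fun x : ℝ ↦ ‖cexp (t * I * x) - ∑ n ∈ S, lam n * cexp ((ω₀ + π * n / a : ℝ) * I * x)‖ ^ 2)
      = fun x : ℝ ↦ ‖e x - Q x‖ ^ 2 := by
    funext x; rw [he, hQ, hb]
  rw [hlhs, hexp, hE, hcross, hgram]
  ring

/-- Grid-zero pairing for a shifted grid. [folklore] -/
private theorem integral_mul_cexp_sub_sum_shift_eq_weilMellin (hg : IsWeilTest g) {a : ℝ} (ω₀ : ℝ) (S : Finset ℤ)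
    (hzero : ∀ n ∈ S, weilMellin g (1 / 2 + ((ω₀ + π * n / a : ℝ) : ℂ) * I) = 0) (lam : ℤ → ℂ) (t : ℝ) :
    ∫ x : ℝ, g x * (cexp (t * I * x) - ∑ n ∈ S, lam n * cexp ((ω₀ + π * n / a : ℝ) * I * x))
      = weilMellin g (1 / 2 + t * I) := by
  have hgc : Continuous g := hg.1.continuous
  have hexpc : ∀ c : ℝ, Continuous fun x : ℝ ↦ cexp (c * I * x) := fun c ↦ by fun_prop
  have i0 : Integrable fun x : ℝ ↦ g x * cexp (t * I * x) := hg.integrable_mul (hexpc t)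
  have iS : ∀ n : ℤ, Integrable fun x : ℝ ↦ g x * (lam n * cexp ((ω₀ + π * n / a : ℝ) * I * x)) :=
    fun n ↦ hg.integrable_mul (continuous_const.mul (hexpc _))
  have e1 : (fun x : ℝ ↦ g x * (cexp (t * I * x) - ∑ n ∈ S, lam n * cexp ((ω₀ + π * n / a : ℝ) * I * x)))
      = fun x ↦ g x * cexp (t * I * x) - ∑ n ∈ S, g x * (lam n * cexp ((ω₀ + π * n / a : ℝ) * I * x)) := by
    funext x
    rw [mul_sub, Finset.mul_sum]
  rw [e1, integral_sub i0 (integrable_finsetSum _ fun n _ ↦ iS n),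
    integral_finsetSum _ fun n _ ↦ iS n, weilMellin_half_line_eq]
  have hv : ∀ n ∈ S, ∫ x : ℝ, g x * (lam n * cexp ((ω₀ + π * n / a : ℝ) * I * x)) = 0 := by
    intro n hn
    have e2 : (fun x : ℝ ↦ g x * (lam n * cexp ((ω₀ + π * n / a : ℝ) * I * x)))
        = fun x ↦ lam n * (g x * cexp ((ω₀ + π * n / a : ℝ) * I * x)) := by
      funext x; ring
    rw [e2, integral_const_mul, ← weilMellin_half_line_eq, hzero n hn, mul_zero]
  rw [Finset.sum_eq_zero hv, sub_zero]

/-- Bessel form for a shifted grid (as `re_inner_le_of_fourierGrid_zero`). [cite: Yoshida1992HermitianForms, §6 (6.4)] -/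
private theorem re_inner_le_of_fourierGrid_zero_shift' (hg : IsWeilTest g) {a : ℝ} (ha : 0 < a)
    (hsupp : tsupport g ⊆ Icc (-a) a) (ω₀ : ℝ) (S : Finset ℤ)
    (hzero : ∀ n ∈ S, weilMellin g (1 / 2 + ((ω₀ + π * n / a : ℝ) : ℂ) * I) = 0)
    (lam : ℤ → ℂ) (t : ℝ) (μ : ℂ) :
    2 * (conj μ * weilMellin g (1 / 2 + t * I)).re ≤
      weilNorm2Sq g + ‖μ‖ ^ 2 *
        ∫ x in (-a)..a, ‖cexp (t * I * x) - ∑ n ∈ S, lam n * cexp ((ω₀ + π * n / a : ℝ) * I * x)‖ ^ 2 := by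
  have hgc : Continuous g := hg.1.continuous
  have hab : -a ≤ a := by linarith
  set h : ℝ → ℂ := fun x ↦ cexp (t * I * x) - ∑ n ∈ S, lam n * cexp ((ω₀ + π * n / a : ℝ) * I * x) with hh
  have hhc : Continuous h := by
    rw [hh]
    exact (by fun_prop : Continuous fun x : ℝ ↦ cexp (t * I * x)).sub
      (continuous_finsetSum _ fun n _ ↦ by fun_prop)
  set Q : ℝ → ℂ := fun x ↦ μ * conj (h x) with hQ
  have hQc : Continuous Q := continuous_const.mul (Complex.continuous_conj.comp hhc)
  have hQs : Continuous fun x ↦ conj (Q x) := Complex.continuous_conj.comp hQc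
  -- (1) `0 ≤ ∫_{-a}^{a} ‖g - Q‖²`
  have h0 : 0 ≤ ∫ x in (-a)..a, ‖g x - Q x‖ ^ 2 :=
    intervalIntegral.integral_nonneg hab fun x _ ↦ sq_nonneg _
  -- (2) expand the square
  have i1 : IntervalIntegrable (fun x ↦ ‖g x‖ ^ 2) volume (-a) a :=
    ((hgc.norm).pow 2).intervalIntegrable _ _
  have i2 : IntervalIntegrable (fun x ↦ ‖Q x‖ ^ 2) volume (-a) a :=
    ((hQc.norm).pow 2).intervalIntegrable _ _
  have iGQ : IntervalIntegrable (fun x ↦ g x * conj (Q x)) volume (-a) a :=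
    (hgc.mul hQs).intervalIntegrable _ _
  have i3 : IntervalIntegrable (fun x ↦ 2 * (g x * conj (Q x)).re) volume (-a) a :=
    (continuous_const.mul (Complex.continuous_re.comp (hgc.mul hQs))).intervalIntegrable _ _
  have hexp : ∫ x in (-a)..a, ‖g x - Q x‖ ^ 2 =
      (∫ x in (-a)..a, ‖g x‖ ^ 2) + (∫ x in (-a)..a, ‖Q x‖ ^ 2) -
        2 * ∫ x in (-a)..a, (g x * conj (Q x)).re := by
    simp_rw [norm_sub_sq_complex]
    rw [intervalIntegral.integral_sub (i1.add i2) i3, intervalIntegral.integral_add i1 i2,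
      intervalIntegral.integral_const_mul]
  -- (3) `∫_{-a}^{a} ‖g‖² = ‖g‖₂²`
  have hN : ∫ x in (-a)..a, ‖g x‖ ^ 2 = weilNorm2Sq g := by
    rw [weilNorm2Sq]
    apply intervalIntegral.integral_eq_integral_of_support_subset
    intro x hx
    have hgx : g x ≠ 0 := fun h0 ↦ hx (by simp [h0])
    exact Ioo_subset_Ioc_self (support_subset_Ioo_of_tsupport_subset_Icc hgc hsupp hgx)
  -- `∫ Re = Re ∫` on `[-a, a]`
  have hre : ∀ {F : ℝ → ℂ}, IntervalIntegrable F volume (-a) a →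
      ∫ x in (-a)..a, (F x).re = (∫ x in (-a)..a, F x).re := by
    intro F hF
    have := ContinuousLinearMap.intervalIntegral_comp_comm Complex.reCLM hF
    simpa only [Complex.reCLM_apply] using this
  -- (4) the cross term: `∫ g conj(Q) = conj μ · ĝ(1/2+it)`
  have hcross : ∫ x in (-a)..a, (g x * conj (Q x)).re =
      (conj μ * weilMellin g (1 / 2 + t * I)).re := by
    rw [hre iGQ]
    congr 1
    have e1 : (fun x ↦ g x * conj (Q x)) = fun x ↦ conj μ * (g x * h x) := by
      funext x
      rw [hQ]
      simp only [map_mul, Complex.conj_conj]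
      ring
    rw [e1, intervalIntegral.integral_const_mul]
    congr 1
    rw [← integral_eq_intervalIntegral_of_tsupport hgc hsupp h, hh]
    exact integral_mul_cexp_sub_sum_shift_eq_weilMellin hg ω₀ S hzero lam t
  -- (5) the trial term: `∫ ‖Q‖² = |μ|² ∫ ‖h‖²`
  have hQQ : ∫ x in (-a)..a, ‖Q x‖ ^ 2 = ‖μ‖ ^ 2 * ∫ x in (-a)..a, ‖h x‖ ^ 2 := by
    rw [← intervalIntegral.integral_const_mul]
    refine intervalIntegral.integral_congr fun x _ ↦ ?_
    simp only [hQ, norm_mul, Complex.norm_conj]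
    ring
  rw [hexp, hN, hcross, hQQ] at h0
  linarith

/-- The window estimate (Cauchy–Schwarz form) for a shifted grid `ω₀ + πn/a`, `n ∈ S`. [cite: Yoshida1992HermitianForms, §6 (6.4)] -/
theorem norm_sq_weilMellin_le_of_fourierGrid_zero_shift (hg : IsWeilTest g) {a : ℝ} (ha : 0 < a)
    (hsupp : tsupport g ⊆ Icc (-a) a) (ω₀ : ℝ) (S : Finset ℤ)
    (hzero : ∀ n ∈ S, weilMellin g (1 / 2 + ((ω₀ + π * n / a : ℝ) : ℂ) * I) = 0)
    (lam : ℤ → ℂ) (t : ℝ) :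
    ‖weilMellin g (1 / 2 + t * I)‖ ^ 2 ≤
      weilNorm2Sq g *
        ∫ x in (-a)..a, ‖cexp (t * I * x) - ∑ n ∈ S, lam n * cexp ((ω₀ + π * n / a : ℝ) * I * x)‖ ^ 2 := by
  have key := fun μ : ℂ ↦ re_inner_le_of_fourierGrid_zero_shift' hg ha hsupp ω₀ S hzero lam t μ
  set z : ℂ := weilMellin g (1 / 2 + t * I) with hz
  set H : ℝ := ∫ x in (-a)..a, ‖cexp (t * I * x) - ∑ n ∈ S, lam n * cexp ((ω₀ + π * n / a : ℝ) * I * x)‖ ^ 2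
    with hH
  have hG : 0 ≤ weilNorm2Sq g := weilNorm2Sq_nonneg g
  have hH0 : 0 ≤ H := intervalIntegral.integral_nonneg (by linarith) fun x _ ↦ sq_nonneg _
  -- `conj z · z = |z|²`
  have hzz : ∀ s : ℝ, (conj ((s : ℂ) * z) * z).re = s * ‖z‖ ^ 2 := by
    intro s
    rw [map_mul, Complex.conj_ofReal, mul_assoc, Complex.re_ofReal_mul, Complex.conj_mul',
      ← Complex.ofReal_pow, Complex.ofReal_re]
  rcases eq_or_lt_of_le hH0 with hH | hH
  · -- `H = 0`: take `μ = s z`, `s → ∞`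
    have hs : ∀ s : ℝ, 2 * (s * ‖z‖ ^ 2) ≤ weilNorm2Sq g := by
      intro s
      have := key ((s : ℂ) * z)
      rw [hzz, ← hH, mul_zero, add_zero] at this
      exact this
    have hz0 : ‖z‖ ^ 2 = 0 := by
      by_contra hne
      have hpos : 0 < ‖z‖ ^ 2 := lt_of_le_of_ne (sq_nonneg _) (Ne.symm hne)
      have := hs ((weilNorm2Sq g + 1) / (2 * ‖z‖ ^ 2))
      have hzne : ‖z‖ ≠ 0 := fun h0 ↦ by rw [h0] at hpos; simp at hpos
      have e : 2 * ((weilNorm2Sq g + 1) / (2 * ‖z‖ ^ 2) * ‖z‖ ^ 2) = weilNorm2Sq g + 1 := by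
        field_simp
      linarith
    rw [hz0, ← hH, mul_zero]
  · -- `H > 0`: take `μ = z / H`
    have := key (((1 / H : ℝ) : ℂ) * z)
    rw [hzz, norm_mul, Complex.norm_real, Real.norm_of_nonneg (by positivity), mul_pow] at this
    -- this : 2 * (1/H * ‖z‖²) ≤ G + (1/H)² ‖z‖² * H
    have e : (1 / H) ^ 2 * ‖z‖ ^ 2 * H = 1 / H * ‖z‖ ^ 2 := by
      field_simp
    rw [e] at this
    have h2 : 1 / H * ‖z‖ ^ 2 ≤ weilNorm2Sq g := by linarith
    calc ‖z‖ ^ 2 = H * (1 / H * ‖z‖ ^ 2) := by field_simp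
      _ ≤ H * weilNorm2Sq g := mul_le_mul_of_nonneg_left h2 hH.le
      _ = weilNorm2Sq g * H := mul_comm _ _

/-- **Window estimate for a shifted grid, explicit (sinc) form.**  For `tsupport g ⊆ [-a, a]` and
`ĝ(1/2 + i(ω₀ + πn/a)) = 0` for `n ∈ S`:
`|ĝ(1/2+it)|² ≤ ‖g‖₂² · (2a − (1/2a) Σ_{n∈S} s_n(t)²)`, `s_n(t) = 2 sin((t − ω₀ − πn/a)a)/(t − ω₀ − πn/a)`
(`= 2a` at `t = ω₀ + πn/a`); `ω₀ = π/(2a)` gives the half-integer grid of the quarter-wave (Neumann) basis.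
[cite: Yoshida1992HermitianForms, §6 (6.4) (finite projection form)] -/
theorem norm_sq_weilMellin_le_of_shiftedGrid_zero_sinc (hg : IsWeilTest g) {a : ℝ} (ha : 0 < a)
    (hsupp : tsupport g ⊆ Icc (-a) a) (ω₀ : ℝ) (S : Finset ℤ)
    (hzero : ∀ n ∈ S, weilMellin g (1 / 2 + ((ω₀ + π * n / a : ℝ) : ℂ) * I) = 0) (t : ℝ) :
    ‖weilMellin g (1 / 2 + t * I)‖ ^ 2 ≤
      weilNorm2Sq g * (2 * a - 1 / (2 * a) * ∑ n ∈ S,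
        (if t = ω₀ + π * n / a then 2 * a
          else 2 * Real.sin ((t - (ω₀ + π * n / a)) * a) / (t - (ω₀ + π * n / a))) ^ 2) := by
  -- frequencies as a finite set of reals
  set s : ℤ → ℝ := fun n ↦ if t = ω₀ + π * n / a then 2 * a
      else 2 * Real.sin ((t - (ω₀ + π * n / a)) * a) / (t - (ω₀ + π * n / a)) with hs_def
  have hs : ∀ n ∈ S, ∫ x in (-a)..a, cexp ((t - (ω₀ + π * n / a) : ℝ) * I * x) = (s n : ℂ) := by
    intro n _
    simp only [hs_def]
    split_ifs with h
    · have : (t - (ω₀ + π * n / a) : ℝ) = 0 := by rw [h]; ring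
      rw [this, intervalIntegral_cexp_zero_mul']
    · exact intervalIntegral_cexp_mul_I' (sub_ne_zero.mpr h)
  -- the Bessel/CS bound with the frequency set `Ω = {ω₀ + πn/a}` realised through the injective map on `S`
  -- (we avoid `Finset.image` and work with the sum over `S` directly by re-running the λ-argument)
  have h := norm_sq_weilMellin_le_of_fourierGrid_zero_shift hg ha hsupp ω₀ S hzero
    (fun n ↦ ((s n / (2 * a) : ℝ) : ℂ)) t
  rw [intervalIntegral_norm_sq_cexp_sub_sum_shift ha.ne' ω₀ S _ t] at h
  have hsum1 : (∑ n ∈ S, conj (((s n / (2 * a) : ℝ) : ℂ)) *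
      ∫ x in (-a)..a, cexp ((t - (ω₀ + π * n / a) : ℝ) * I * x)).re = ∑ n ∈ S, s n / (2 * a) * s n := by
    rw [Complex.re_sum]
    refine Finset.sum_congr rfl fun n hn ↦ ?_
    rw [hs n hn, Complex.conj_ofReal, ← Complex.ofReal_mul, Complex.ofReal_re]
  have hsum2 : ∑ n ∈ S, ‖(((s n / (2 * a) : ℝ) : ℂ))‖ ^ 2 = ∑ n ∈ S, (s n / (2 * a)) ^ 2 := by
    refine Finset.sum_congr rfl fun n _ ↦ ?_
    rw [Complex.norm_real, Real.norm_eq_abs, sq_abs]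
  rw [hsum1, hsum2] at h
  have e : 2 * a - 2 * ∑ n ∈ S, s n / (2 * a) * s n + 2 * a * ∑ n ∈ S, (s n / (2 * a)) ^ 2
      = 2 * a - 1 / (2 * a) * ∑ n ∈ S, s n ^ 2 := by
    rw [Finset.mul_sum, Finset.mul_sum, Finset.mul_sum]
    have h1 : ∀ n ∈ S, 2 * (s n / (2 * a) * s n) = 1 / (2 * a) * s n ^ 2 + 1 / (2 * a) * s n ^ 2 := by
      intro n _; field_simp; ring
    have h2 : ∀ n ∈ S, 2 * a * (s n / (2 * a)) ^ 2 = 1 / (2 * a) * s n ^ 2 := by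
      intro n _; field_simp
    rw [Finset.sum_congr rfl h1, Finset.sum_congr rfl h2, Finset.sum_add_distrib]
    ring
  rw [e] at h
  exact h

end Literature.NumberTheory.LFunctions
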